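import Literature.AlgebraicGeometry.HodgeTheory.GAGALineBundlesHolds
import Literature.AlgebraicGeometry.HodgeTheory.AbelianVarietyUniformisationPicardConverse
import Literature.AlgebraicGeometry.HodgeTheory.ComplexConjugationDischarge
import Literature.AlgebraicGeometry.Motives.AbelianVarietyProjectiveChart
import Literature.AlgebraicGeometry.Motives.HodgeDecompositionIsInternalDischarge
import Literature.Geometry.Kaehler.ComplexTorusKaehler
import HarnessLib

/-!
# GAGA surjectivity on `Pic` in torus currency: every Appell–Humbert class is algebraic

Layer `Literature/AlgebraicGeometry/HodgeTheory`, namespace `Literature.AlgebraicGeometry.HodgeTheory`; sibling of ★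
`GAGAPicardInjective`.  THEOREMS ONLY (no definition, no named fact, no instance, no `sorry`).

For a complex abelian variety `A` uniformised by a complex torus `φ : X = V/Φ(ℤ^ι) → A(ℂ)` (an analytification) and ANY
Appell–Humbert datum `p = (H, χ)` on `X`, the class `L(H, χ) ∈ Pic(X)` is the class of the analytified line bundle
`𝒪_A(D)^an` of an ALGEBRAIC Cartier divisor `D` on `A`:
`∃ D, picClass (cartierDivisorLineBundle hφ D) = AHData.toPic p` (`exists_cartierDivisor_picClass_eq_toPic`).
This is Serre's GAGA for line bundles ([SerreGAGA1956] n° 20 Prop. 18: `H¹(X, 𝒪^×) → H¹(X^h, 𝒪_h^×)` is bijective for `X`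
projective) composed with `Pic = CaCl` on the integral scheme `A` ([GortzWedhorn2020] Prop. 11.21) and with Appell–Humbert
([Lange2023AbelianVarietiesComplex] §1.2.1 Prop. 1.2.2–1.2.3, Thm. 1.3.3: `Pic(X) = H¹(Λ, H⁰(𝒪_V^×))`, `L ↦ φ₁⁻¹ L`).
Thirteen tree files take the conclusion as the hypothesis `hp : AHData.toPic p = picClass (cartierDivisorLineBundle hφ Θ)`;
this file PRODUCES it (cell `hodgecm-mathlib`, U-DAG node U-aΘ L1 `UaTheta_L1_producer`, whose text is
`uaTheta_L1_producer` below verbatim).  HC_CM is proved only modulo the printed citations until rung 0 closes.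

Proof (all engines ★): the complex torus with `φ` is a HODGE MODEL of `A` (built inline: ★ `ComplexTorus.instIsKaehlerManifold`,
★ `Motives.isInternal_hodgePQ_holds`, ★ `exists_isNatural_deRhamIsoFamily_complexModel`); ★
`serreGAGA_lineCocycle_iso_cartierDivisorCocycle_holds` (with ★ `AbelianVariety.isSmoothProjective_holds`) gives `D` and a
holomorphic cocycle isomorphism `L(H, χ) ≅ 𝒪_A(D)^an`; ★ `cartierDivisorLineBundle_toSmoothCocycle`, ★
`picClass_eq_iff_analyticallyEquivalent` and ★ `picClass_lineBundleAH` turn it into the `picClass` equation.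

## References
* [SerreGAGA1956] J.-P. Serre, *Géométrie algébrique et géométrie analytique*, Ann. Inst. Fourier 6 (1956), n° 20 Prop. 18.
* [GortzWedhorn2020] U. Görtz, T. Wedhorn, *Algebraic Geometry I* (2nd ed. 2020), Prop. 11.21 (p. 374).
* [Lange2023AbelianVarietiesComplex] H. Lange, *Abelian Varieties over the Complex Numbers* (2023), §1.2.1 Prop. 1.2.2–1.2.3 (p. 21),
  §1.3.2 Thm. 1.3.3 (p. 30).
-/

set_option autoImplicit false

noncomputable section

open scoped Manifold ContDiff
open Literature.AlgebraicGeometry.Motives Literature.Geometry.Kaehler Literature.Geometry.Kaehler.ComplexTorus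
open Literature.NumberTheory.Transcendental

namespace Literature.AlgebraicGeometry.HodgeTheory

/-- **GAGA surjectivity on `Pic` in torus currency — every Appell–Humbert class `L(H, χ)` on a uniformised complex abelian
variety is `[𝒪_A(D)^an]` for an algebraic Cartier divisor `D`.** [cite: SerreGAGA1956, n° 20 Prop. 18]
[cite: GortzWedhorn2020, Prop. 11.21 (p. 374)] [cite: Lange2023AbelianVarietiesComplex, §1.2.1 Prop. 1.2.2–1.2.3 (p. 21)] -/
theorem exists_cartierDivisor_picClass_eq_toPic (A : AbelianVariety ℂ) (ι : Type) [Fintype ι]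
    (Φ : (ι → ℝ) ≃L[ℝ] (Fin A.dim → ℂ)) (φ : ComplexTorus Φ → ComplexPoints A.X)
    (hφ : IsAnalytification (Fin A.dim → ℂ) A.X A.dim φ) (p : AHData Φ) :
    ∃ D : CartierDivisor A.X.left, picClass (cartierDivisorLineBundle hφ D) = AHData.toPic p := by
  -- a natural complex de Rham comparison family on manifolds charted on `ℂ^g`
  obtain ⟨e, he⟩ := exists_complexDeRhamIsoFamily_of_exists_isNatural
    (exists_isNatural_deRhamIsoFamily_complexModel (Fin A.dim → ℂ))
  -- GAGA for the holomorphic line cocycle of `L(H, χ)` on the torus Hodge model of `A`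
  obtain ⟨D, Ψ, hΨ⟩ := serreGAGA_lineCocycle_iso_cartierDivisorCocycle_holds
    (AbelianVariety.isSmoothProjective_holds (A := A))
    { model := Fin A.dim → ℂ, carrier := ComplexTorus Φ, toComplexPoints := φ, isAnalytification := hφ,
      deRham := e, deRham_isNatural := he,
      isInternal_hodgePQ := fun k => Literature.AlgebraicGeometry.Motives.isInternal_hodgePQ_holds k }
    (ι → ℝ) p.lineBundle.toSmoothCocycle p.lineBundle.toSmoothCocycle_isHolomorphic
  refine ⟨D, ?_⟩
  have h1 : picClass p.lineBundle = AHData.toPic p := picClass_lineBundle (AHData.toFactor p)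
  have h2 : picClass p.lineBundle = picClass (cartierDivisorLineBundle hφ D) :=
    (picClass_eq_iff_analyticallyEquivalent p.lineBundle (cartierDivisorLineBundle hφ D)).2 ⟨Ψ, hΨ⟩
  exact h2.symm.trans h1

/-- **U-aΘ L1 (the cell's socket `UaTheta_L1_producer`, text verbatim)**: the group-law compatibility `_hadd` of the
uniformisation is not needed. [cite: SerreGAGA1956, n° 20 Prop. 18] [cite: Lange2023AbelianVarietiesComplex, §1.2.1 Prop. 1.2.2–1.2.3 (p. 21)] -/
theorem uaTheta_L1_producer :
    ∀ (A : AbelianVariety ℂ) (ι : Type) [Fintype ι] (Φ : (ι → ℝ) ≃L[ℝ] (Fin A.dim → ℂ))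
      (φ : ComplexTorus Φ → ComplexPoints A.X) (hφ : IsAnalytification (Fin A.dim → ℂ) A.X A.dim φ)
      (_hadd : ∀ x y, φ (x + y) = φ x * φ y) (p : AHData Φ),
      ∃ D : CartierDivisor A.X.left, picClass (cartierDivisorLineBundle hφ D) = AHData.toPic p :=
  fun A ι _ Φ φ hφ _ p => exists_cartierDivisor_picClass_eq_toPic A ι Φ φ hφ p

end Literature.AlgebraicGeometry.HodgeTheory

end
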